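import Literature.NumberTheory.GelbartRogawski1991.LocalSymplecticEmbeddingGaloisConj
import Literature.NumberTheory.Automorphic.UnitaryGroupLocalCenterScalar
import Literature.NumberTheory.Automorphic.LocalUnitaryGroupUnimodular
import HarnessLib

/-!
# `g ↦ ḡ` on `U(J)(F_v)` inverts the centre and the determinant

Topic `NumberTheory/GelbartRogawski1991`; namespace `Literature.NumberTheory.Automorphic.UnitaryGroup` (home of ★ `localGalConj`,
`localPiGalConj`, `localCenter`, `localUnitScalar`, `conjLocal_det_mul_det`).  KERNEL ONLY: theorems; no definition, no named fact, no
`sorry`.  Cell `hodgecm-mathlib` (D-0151), programme P5 (crux HLiu418 = stmt-HodgeConjecture-24832), stone **L2′** of the road card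
`F0/P5/A-p18/g23/ROAD-L4if-v2.A-p18g23.md` (A-p18 (g23), 2026-08-31): the centre∕determinant bookkeeping of step (M1) — for a
representation `π` of `U(J)(F_v)` whose centre `E_v¹` acts by `χ`, the conjugate `g ↦ π(ḡ)` (★ `localPiGalConj`, p834029) has central
character `χ ∘ inv = χ⁻¹`, and its `det`-twists are read through `det ḡ = (det g)⁻¹`.

THE MATHEMATICS ([MoeglinVignerasWaldspurger1987, Chap. 1 I.17]; [Mok2014, §1]: the centre of `U(J)` is `U(1)_{E/F}` = the norm-one
scalars).  `E_v = E ⊗_F F_v`, `c ⊗ 1` its conjugation (★ `conjLocal`), `z ∈ E_vˣ` with `z · (c⊗1)(z) = 1` (norm one), so `(c ⊗ 1)(z) = z⁻¹`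
(`conjLocal_eq_inv_of_norm_one`).  Hence:
* §1 the conjugate of the central element `z · 1_N` (★ `localCenter … (localUnitScalar z)`) is `z⁻¹ · 1_N`
  (`localGalConj_localCenter_localUnitScalar`, `localPiGalConj_localCenter_localUnitScalar`);
* §2 `det ḡ = (c ⊗ 1)(det g) = (det g)⁻¹` for `g ∈ U(J)(F_v)` (★ `conjLocal_det_mul_det`): `val_det_localGalConj`, `det_localGalConj_mul_det`,
  `det_localGalConj_eq_inv`;
* §3 on the rank-one group `U(J₁)(F_v)` (`J₁ = (t)`, `t ∈ Fˣ`, the centre itself) conjugation IS inversion (`localGalConj_eq_inv_rankOne`).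
Nothing of the cited sources is asserted; HC_CM is proved only modulo the printed citations until rung 0 closes.

## References
* [MoeglinVignerasWaldspurger1987] C. Mœglin, M.-F. Vignéras, J.-L. Waldspurger, LNM 1291 (1987), Chap. 1 I.17.
* [Mok2014] C. P. Mok, *Endoscopic classification of representations of quasi-split unitary groups*, Mem. AMS 235 (2015), §1 Notation p. 5
  («we identify the centre of `U_{E/F}(N)` as `U_{E/F}(1)`»).
-/

set_option autoImplicit false

noncomputable section

open NumberField IsDedekindDomain Matrix

namespace Literature.NumberTheory.Automorphic.UnitaryGroup

variable {F : Type} (E : Type) [Field F] [NumberField F] [Field E] [NumberField E] [Algebra F E]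
variable (c : E ≃ₐ[F] E) (N : ℕ) {T : Matrix (Fin N) (Fin N) F} {J : Matrix (Fin N) (Fin N) E} (J₁ : Matrix (Fin 1) (Fin 1) E)
  (v : HeightOneSpectrum (𝓞 F))

/-! ## §0 Norm-one scalars: `(c ⊗ 1)(z) = z⁻¹` -/

/-- For a norm-one unit `z` of `E_v` (`z · (c⊗1) z = 1`): `(c ⊗ 1)(z) = z⁻¹`. [cite: Mok2014, §1 Notation p. 5] -/
theorem conjLocal_eq_inv_of_norm_one (z : (LocalRing E v)ˣ) (hz : (z : LocalRing E v) * conjLocal E c v z = 1) :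
    conjLocal E c v z = ((z⁻¹ : (LocalRing E v)ˣ) : LocalRing E v) :=
  (eq_inv_of_mul_eq_one_right hz).trans (Units.val_inv_eq_inv_val z).symm

/-- The inverse of a norm-one unit has norm one. [cite: Mok2014, §1 Notation p. 5] -/
theorem norm_one_inv [Algebra.IsQuadraticExtension F E] {δ : E} (hcδ : c δ = -δ) (hδ : δ ≠ 0) (z : (LocalRing E v)ˣ)
    (hz : (z : LocalRing E v) * conjLocal E c v z = 1) :
    ((z⁻¹ : (LocalRing E v)ˣ) : LocalRing E v) * conjLocal E c v ((z⁻¹ : (LocalRing E v)ˣ) : LocalRing E v) = 1 := by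
  have h : conjLocal E c v ((z⁻¹ : (LocalRing E v)ˣ) : LocalRing E v) = z := by
    rw [← conjLocal_eq_inv_of_norm_one E c v z hz, Liu2021.LemD1OfPlace.conjLocal_conjLocal_apply E v c hcδ hδ]
  rw [h, Units.inv_mul]

/-! ## §1 The conjugate of a central element is its inverse -/

/-- **`bar (z · 1_N) = z⁻¹ · 1_N`** on `U(J)(F_v)` (`J = T ⊗ 1`): the Galois conjugate of the central element of a norm-one scalar `z` is
the central element of `z⁻¹`. [cite: MoeglinVignerasWaldspurger1987, Chap. 1 I.17] -/
theorem localGalConj_localCenter_localUnitScalar [Algebra.IsQuadraticExtension F E] {δ : E} (hcδ : c δ = -δ) (hδ : δ ≠ 0)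
    (hJ : J = T.map (algebraMap F E)) (hJ₁ : J₁ 0 0 ≠ 0) (z : (LocalRing E v)ˣ) (hz : (z : LocalRing E v) * conjLocal E c v z = 1) :
    localGalConj E c N v hJ (localPiEquiv E c N J v (localCenter E c N J J₁ hJ₁ v (localUnitScalar E c J₁ v z hz))) =
      localPiEquiv E c N J v (localCenter E c N J J₁ hJ₁ v (localUnitScalar E c J₁ v z⁻¹ (norm_one_inv E c v hcδ hδ z hz))) := by
  refine Subtype.ext (Units.ext ?_)
  rw [val_localGalConj]
  rw [coe_localPiEquiv_localCenter_localUnitScalar, coe_localPiEquiv_localCenter_localUnitScalar, map_smul_one,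
    conjLocal_eq_inv_of_norm_one E c v z hz]

/-- The same on the factor form `localPi` (★ `localPiGalConj`). [cite: MoeglinVignerasWaldspurger1987, Chap. 1 I.17] -/
theorem localPiGalConj_localCenter_localUnitScalar [Algebra.IsQuadraticExtension F E] {δ : E} (hcδ : c δ = -δ) (hδ : δ ≠ 0)
    (hJ : J = T.map (algebraMap F E)) (hJ₁ : J₁ 0 0 ≠ 0) (z : (LocalRing E v)ˣ) (hz : (z : LocalRing E v) * conjLocal E c v z = 1) :
    localPiGalConj E c N v hJ (localCenter E c N J J₁ hJ₁ v (localUnitScalar E c J₁ v z hz)) =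
      localCenter E c N J J₁ hJ₁ v (localUnitScalar E c J₁ v z⁻¹ (norm_one_inv E c v hcδ hδ z hz)) := by
  apply (localPiEquiv E c N J v).injective
  rw [localPiEquiv_localPiGalConj, localGalConj_localCenter_localUnitScalar E c N J₁ v hcδ hδ hJ hJ₁ z hz]

/-! ## §2 `det ḡ = (det g)⁻¹` -/

/-- `det ḡ = (c ⊗ 1)(det g)`. [cite: MoeglinVignerasWaldspurger1987, Chap. 1 I.17] -/
theorem val_det_localGalConj (hJ : J = T.map (algebraMap F E)) (g : «local» E c N J v) :
    (localGalConj E c N v hJ g).1.1.det = conjLocal E c v g.1.1.det := by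
  rw [val_localGalConj, ← RingHom.mapMatrix_apply, ← RingHom.map_det]

/-- **`det ḡ · det g = 1`** on `U(J)(F_v)` (`J = T ⊗ 1`, `det T` a unit): the determinant of the conjugate is the inverse determinant
(★ `conjLocal_det_mul_det`). [cite: MoeglinVignerasWaldspurger1987, Chap. 1 I.17] -/
theorem det_localGalConj_mul_det (hTd : IsUnit T.det) (hJ : J = T.map (algebraMap F E)) (g : «local» E c N J v) :
    (localGalConj E c N v hJ g).1.1.det * g.1.1.det = 1 := by
  rw [val_det_localGalConj]
  have hJd : IsUnit J.det := by
    rw [hJ, ← RingHom.mapMatrix_apply, ← RingHom.map_det]; exact hTd.map _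
  exact conjLocal_det_mul_det c hJd g

/-- … as units: `det ḡ = (det g)⁻¹` in `E_vˣ` (★ `Matrix.GeneralLinearGroup.det`). [cite: MoeglinVignerasWaldspurger1987, Chap. 1 I.17] -/
theorem det_localGalConj_eq_inv (hTd : IsUnit T.det) (hJ : J = T.map (algebraMap F E)) (g : «local» E c N J v) :
    Matrix.GeneralLinearGroup.det (localGalConj E c N v hJ g).1 = (Matrix.GeneralLinearGroup.det g.1)⁻¹ :=
  eq_inv_of_mul_eq_one_left (Units.ext (det_localGalConj_mul_det E c N v hTd hJ g))

/-! ## §3 Rank one: conjugation is inversion on `U(J₁)(F_v) = E_v¹` -/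

/-- **On the rank-one group `U(J₁)(F_v)` (`J₁ = (t) ⊗ 1`, `t ∈ Fˣ`), `ḡ = g⁻¹`**: a `1 × 1` unitary matrix is a norm-one scalar, so
`det ḡ · det g = 1` (§2) says `ḡ g = 1`. [cite: Mok2014, §1 Notation p. 5] -/
theorem localGalConj_eq_inv_rankOne {T₁ : Matrix (Fin 1) (Fin 1) F} {J₁' : Matrix (Fin 1) (Fin 1) E} (hT₁ : IsUnit T₁.det)
    (hJ₁' : J₁' = T₁.map (algebraMap F E)) (g : «local» E c 1 J₁' v) : localGalConj E c 1 v hJ₁' g = g⁻¹ := by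
  apply eq_inv_of_mul_eq_one_left
  refine Subtype.ext (Units.ext ?_)
  have h := det_localGalConj_mul_det E c 1 v hT₁ hJ₁' g
  rw [Matrix.det_fin_one, Matrix.det_fin_one] at h
  rw [Subgroup.coe_mul, Units.val_mul, Subgroup.coe_one, Units.val_one]
  refine Matrix.ext fun i j => ?_
  fin_cases i; fin_cases j
  simpa [Matrix.mul_apply] using h

end Literature.NumberTheory.Automorphic.UnitaryGroup

end
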